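import Summits.CriticalPhenomena.PercolationContinuityZ3.Theorems.PercNearOneGluingNoHeavyLowerTailSunflowerMultiPetalKempeMarkedExpansion
import HarnessLib
import HarnessLib.Audit

/-!
# `NoHeavyLowerTail` (crux stmt-CriticalPhenomena-4575), marked-multigraph layer: the Q-SIDE ONE-POINT EXPANSION (first ingredient of THEOREM R for
# marked multigraphs) and monotone deletion of a marked vertex for the Lemma-B functional

Support file (seat `prim-l12-p2` gen 47; `--supports stmt-CriticalPhenomena-4575`; continuation of `…KempeMarkedExpansion` (p595201) and of the simple-graph
`…KempePinned` (p414773: `kerAbs`, `kerAbs_nonneg_of_ne_zero`)).  No `sorry`; nothing is asserted about the crux.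
Memo: run/shared/lean/prim/prim-l12/prim-l12-p2/FINDING-g47-NEIGHBOURHOOD-CONTRACTION-STEP.md §6 (iv), PROOF-LEMMA-B-MARKED-MULTIGRAPHS-g47.md §1 (THEOREM R).

* `QcolM_eq_sum_extCol` — `Q(K)` as a double sum over the colourings of `V ∖ {y}` and the colour of `y`;
* **`three_mul_QcolM_sub_QcolM_isolate`** — `3·Q(K) − Q(K.isolate y) = 3·Σ_τ kerAbs (type_{K−y} τ) (profM τ)`;
* **`QcolM_isolate_le_of_mark`** — a marked vertex is deleted monotonically: `Q(K.isolate y) ≤ 3·Q(K)` (case (i) of THEOREM R);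
* `kerAbs_zero_profile` — the kernel at the empty profile is `2·lbW`.
The remaining ingredients of THEOREM R (class decomposition at `N(x)`: monochromatic classes ↦ `QcolM` of contractions, two-colour classes ↦ `TfunM` of a
contraction) are the next formalization step (memo §6 (iv)).
-/

namespace Summit.CriticalPhenomena.PercolationContinuityZ3.Theorems.SunflowerPartition.Kempe

open Finset

namespace MGraph

variable {V : Type*} [Fintype V] [LinearOrder V] (K : MGraph V)

/-! ## The Q-side (Lemma B) one-point expansion in the marked-multigraph layer -/

section QSide

variable (y : V)

/-- `QcolM` as a double sum over the colourings of `V ∖ {y}` and the colour of `y`. [this work] -/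
theorem QcolM_eq_sum_extCol : K.QcolM = ∑ τ : (({y}ᶜ : Set V)) → Fin 3, ∑ c : Fin 3, lbW (K.ctypeM (extCol y τ c)) := by
  unfold QcolM
  rw [← Fintype.sum_prod_type']
  exact Fintype.sum_equiv ((Equiv.refl _).trans
      { toFun := fun σ => (σ ∘ Subtype.val, σ y), invFun := fun p => extCol y p.1 p.2,
        left_inv := fun σ => extCol_restrict y σ, right_inv := fun p => Prod.ext (extCol_comp_val y p.1 p.2) (extCol_self y p.1 p.2) })
    _ _ (fun σ => by simp [extCol_restrict])

/-- **THE Q-SIDE ONE-POINT EXPANSION**: `3·Q(K) − Q(K.isolate y) = 3·Σ_τ kerAbs (type_{K−y} τ) (profM τ)` (the marked-multigraph version of p414773's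
`kerMZ_eq_kerAbs` summed; the factor `3` because `K.isolate y` keeps `y` as an isolated unmarked vertex).  This is the first ingredient of THEOREM R
in the MGraph layer. [this work] -/
theorem three_mul_QcolM_sub_QcolM_isolate :
    3 * K.QcolM - (K.isolate y).QcolM = 3 * ∑ τ : (({y}ᶜ : Set V)) → Fin 3, kerAbs ((K.isolate y).ctypeM (extCol y τ 0)) (K.profM y (extCol y τ 0)) := by
  rw [K.QcolM_eq_sum_extCol y, (K.isolate y).QcolM_eq_sum_extCol y, mul_sum, mul_sum, ← sum_sub_distrib]
  refine sum_congr rfl fun τ _ => ?_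
  unfold kerAbs
  rw [Fin.sum_univ_three, Fin.sum_univ_three,
    K.ctypeM_eq_ctAdd_isolate y (extCol y τ 0), K.ctypeM_eq_ctAdd_isolate y (extCol y τ 1), K.ctypeM_eq_ctAdd_isolate y (extCol y τ 2),
    extCol_self, extCol_self, extCol_self,
    K.ctypeM_isolate_extCol y τ 1 0, K.ctypeM_isolate_extCol y τ 2 0, K.profM_extCol y τ 1 0, K.profM_extCol y τ 2 0]
  unfold xPart
  simp only [if_true, Fin.isValue]
  ring_nf

/-- **A MARKED vertex is deleted monotonically for `Q`**: if `mark y ≠ 0` then `Q(K.isolate y) ≤ 3·Q(K)`, i.e. `Q(K−y) ≤ Q(K)` (case (i) of THEOREM R;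
`kerAbs_nonneg_of_ne_zero`, p414773). [this work] -/
theorem QcolM_isolate_le_of_mark (hmark : K.mark y ≠ 0) : (K.isolate y).QcolM ≤ 3 * K.QcolM := by
  have h := K.three_mul_QcolM_sub_QcolM_isolate y
  have hnn : 0 ≤ ∑ τ : (({y}ᶜ : Set V)) → Fin 3, kerAbs ((K.isolate y).ctypeM (extCol y τ 0)) (K.profM y (extCol y τ 0)) := by
    refine sum_nonneg fun τ _ => kerAbs_nonneg_of_ne_zero _ _ ?_ ?_ ?_
    · exact cap3_ne_zero (by omega)
    · exact cap3_ne_zero (by omega)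
    · exact cap3_ne_zero (by omega)
  linarith

/-- An ISOLATED UNMARKED vertex triples `Q`: `Q(K) = 3·Q(K')`... in the same-vertex-type form, if `y` is isolated and unmarked in `K` then `K.isolate y = K`,
so the expansion reads `2·Q(K) = 3·Σ_τ kerAbs(…, (0,0,0)) = 3·Σ_τ 2·lbW` — recorded as: the kernel at the empty profile is `2·lbW t`. (finite check) [this work] -/
theorem kerAbs_zero_profile : ∀ t : CType, kerAbs t (0, 0, 0) = 2 * lbW t := by decide

end QSide

end MGraph

end Summit.CriticalPhenomena.PercolationContinuityZ3.Theorems.SunflowerPartition.Kempe
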